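import Mathlib
import Summits.NavierStokesRegularity.NavierStokesRegularity.Theorems.SubOnsagerCeilingGapFamily
import HarnessLib

/-!
# The design «d147θ» as a `GapFamily.Params` datum, with its admissibility
(helper file for crux stmt-NavierStokesRegularity-27057 `SubOnsagerCeiling.ForwardTailCeilingKP`, `--supports … --as helper`;
LEAD SOC g11, line «kp-shell-barrier», parametric route)

`d147θ` = the coefficients found by the LEAD's bound-based certifier-in-the-loop fitter (`fit2.py`, three iterations from the d45
coordinate-search variant) for the slice `b ∈ [147/100, 149/100]`, where «d45» itself is not certifiable; same topology (caps 49/50,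
cubic floors 9/20·x³ − 1/1000, re-tuned corner caps and quadric floors).
`d147θ_adm : d147θ.Adm` (decided by `norm_num`) and `d147θ_a0 : d147θ.a0 ≠ 0`. HONEST FRAMING: MODEL-lattice datum; nothing
here bears on Navier–Stokes regularity; 27057 stays OPEN. [cite: BarbatoMorandinRomito2011, §2 Lemma 2.1]
-/

noncomputable section

-- the sub-problem namespace `NavierStokesRegularity.NavierStokesRegularity` is the tree's layout (D-0017)
set_option linter.dupNamespace false

namespace Summit.NavierStokesRegularity.NavierStokesRegularity.Theorems.VirtualFloor.GapFamily

/-- The design «d147θ». [folklore] -/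
def d147θ : Params := { kap := (9/20), eps := (1/1000), a0 := (153497/50000), a1 := (263/250), a2 := (2137/100000), ac := (381957/100000), b1 := (497/250), bc := (13921/5000), fc := (-69383/12500), f0 := (24913/25000), f1 := (279959/50000), f2 := (164359/100000), f00 := (3567/100000), f11 := (96963/100000), f22 := (427903/100000), f01 := (2761/50000), f02 := (-118549/100000), f12 := (-150493/25000), gc := (-3473/1000), g0 := (50209/100000), g1 := (62613/12500), g2 := (-2731/500), g00 := (14817/100000), g11 := (1007/100000), g22 := (92221/20000), g01 := (-1/2500), g02 := (-2547/50000), g12 := (137/50000) }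

/-- «d147θ» is admissible. [folklore] -/
theorem d147θ_adm : d147θ.Adm := by
  constructor <;> norm_num [d147θ, Params.pos]

/-- Its corner-cap A leading coefficient is non-zero. [folklore] -/
theorem d147θ_a0 : d147θ.a0 ≠ 0 := by norm_num [d147θ]

end Summit.NavierStokesRegularity.NavierStokesRegularity.Theorems.VirtualFloor.GapFamily

end
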